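import Literature.MathematicalPhysics.QuantumManyBody.BosonicFloorSymmetrisation
import Literature.MathematicalPhysics.QuantumManyBody.BoseEinsteinCondensation
import Mathlib.Analysis.Calculus.FDeriv.Extend
import Mathlib.Analysis.Calculus.ContDiff.Deriv
import HarnessLib

/-!
# Crux `HardSphereBEC` (stmt-AtomisticToContinuum-11885), line `birth` (skeleton v5):
# the registered stub `stub_smoothSectors` (T2)

Supports (does not close) stmt-AtomisticToContinuum-11885; stub `stub_smoothSectors` of the
birth line (lead c8, skeleton v5). **Smoothed phase sectors of a trial state.** For an admissible
trial state `Ψ ∈ TrialState N L` and `ε > 0` we construct four functions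
`G₀, G₁, G₂, G₃ : (ℝ³)^N → ℂ`, each `C¹`, vanishing wherever `Ψ` does, Bose-symmetric and real
non-negative, dominated IN SUM by `Ψ` in kinetic density (`Σ_j |∇G_j|² ≤ |∇Ψ|²`) and in modulus
(`Σ_j G_j² ≤ |Ψ|²`), and squeezed against the exact phase sectors
`P₀ = (Re Ψ)⁺, P₁ = (Re Ψ)⁻, P₂ = (Im Ψ)⁺, P₃ = (Im Ψ)⁻`: `G_j ≤ P_j ≤ G_j + ε` pointwise.

Construction. With the one-variable `C¹` profile
`p_ε(t) = √(ε² + (t⁺)²) − ε` (`t⁺ = max t 0`; for `t ≥ 0` this is the regularised modulus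
`√(ε² + t²) − ε` of `BosonicFloorSymmetrisation`, for `t ≤ 0` it vanishes identically) put
`G_j = p_ε ∘ ℓ_j ∘ Ψ` (complexified) for the four real-linear functionals
`ℓ = (Re, −Re, Im, −Im)`. The profile satisfies `p_ε(t) = 0` for `t ≤ 0`,
`0 ≤ p_ε(t) ≤ t⁺ ≤ p_ε(t) + ε`, `p_ε(t)² + p_ε(−t)² ≤ t²`, and has the continuous derivative
`p_ε'(t) = t⁺ / √(ε² + (t⁺)²) ∈ [0, 1)`, vanishing for `t ≤ 0`, so that
`p_ε'(t)² + p_ε'(−t)² ≤ 1`. By the chain rule `D G_j(X) u = p_ε'(ℓ_j Ψ(X)) · ℓ_j (DΨ(X) u)`,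
whence for every direction `u`
`Σ_j ‖D G_j(X) u‖² = (p_ε'(a)² + p_ε'(−a)²) (Re DΨ u)² + (p_ε'(b)² + p_ε'(−b)²) (Im DΨ u)² ≤ ‖DΨ(X) u‖²`
(`a = Re Ψ(X)`, `b = Im Ψ(X)`), and `Σ_j G_j(X)² ≤ a² + b² = |Ψ(X)|²`. The `C¹` regularity of
`(t⁺)²` (derivative `2t⁺`) is the one-dimensional case of the derivative of the absolute value /
positive part [Lieb–Loss, *Analysis*, Thm. 6.17]; the kinetic domination is the (trivial, scalar)
case of the convexity inequality for gradients [ibid., Thm. 7.8].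

## References

* [LiebLoss2001] E. H. Lieb, M. Loss, *Analysis*, 2nd ed., AMS 2001, Thm. 6.17, Thm. 7.8.
-/

noncomputable section

open Filter Topology
open scoped ENNReal NNReal

namespace Summit.AtomisticToContinuum.BoseEinsteinCondensation.Cruxes.HardSphereBEC.Birth

open Literature.MathematicalPhysics.QuantumManyBody.BoseGas

namespace SmoothSectors

/-! ### The profile `p_ε(t) = √(ε² + (t⁺)²) − ε` -/

/-- `p_ε'(t) = t⁺ / √(ε² + (t⁺)²)` for `ε > 0`. The positive part squared `t ↦ (t⁺)²` has the
continuous derivative `2t⁺` (off the origin it is locally `t²` or `0`; at the origin the derivative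
extends continuously — the one-dimensional case of the derivative of `|f|` / `f⁺`), and the square
root is taken at arguments `≥ ε² > 0`. [cite: LiebLoss2001, Thm. 6.17] -/
theorem hasDerivAt_profile {ε : ℝ} (hε : 0 < ε) (t : ℝ) :
    HasDerivAt (fun s : ℝ => Real.sqrt (ε ^ 2 + (max s 0) ^ 2) - ε)
      (max t 0 / Real.sqrt (ε ^ 2 + (max t 0) ^ 2)) t := by
  -- `d/dt (t⁺)² = 2 t⁺`
  have hq : HasDerivAt (fun s : ℝ => (max s 0) ^ 2) (2 * max t 0) t := by
    refine hasDerivAt_of_hasDerivAt_of_ne' (x := 0) (f := fun s : ℝ => (max s 0) ^ 2)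
      (g := fun s : ℝ => 2 * max s 0) (fun y hy => ?_) ?_ ?_ t
    · rcases lt_or_gt_of_ne hy with hy | hy
      · have h : (fun s : ℝ => (max s 0) ^ 2) =ᶠ[𝓝 y] fun _ => (0 : ℝ) :=
          (gt_mem_nhds hy).mono fun s hs => by
            show (max s 0) ^ 2 = 0
            rw [max_eq_right (le_of_lt hs)]; ring
        rw [max_eq_right hy.le, mul_zero]
        exact (hasDerivAt_const y (0 : ℝ)).congr_of_eventuallyEq h
      · have h : (fun s : ℝ => (max s 0) ^ 2) =ᶠ[𝓝 y] fun s => s ^ 2 :=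
          (lt_mem_nhds hy).mono fun s hs => by
            show (max s 0) ^ 2 = s ^ 2
            rw [max_eq_left (le_of_lt hs)]
        rw [max_eq_left hy.le]
        have h2 := hasDerivAt_pow 2 y
        simp only [Nat.cast_ofNat, Nat.add_one_sub_one, pow_one] at h2
        exact h2.congr_of_eventuallyEq h
    · exact ((continuous_id.max continuous_const).pow 2).continuousAt
    · exact (continuous_const.mul (continuous_id.max continuous_const)).continuousAt
  have hpos : ε ^ 2 + (max t 0) ^ 2 ≠ 0 := ne_of_gt (by positivity)
  exact (((hq.const_add (ε ^ 2)).sqrt hpos).sub_const ε).congr_deriv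
    (mul_div_mul_left _ _ (two_ne_zero' ℝ))

/-- `p_ε` is `C¹` for `ε > 0`: its derivative `t⁺ / √(ε² + (t⁺)²)` is continuous. [folklore] -/
theorem contDiff_profile {ε : ℝ} (hε : 0 < ε) :
    ContDiff ℝ 1 (fun s : ℝ => Real.sqrt (ε ^ 2 + (max s 0) ^ 2) - ε) := by
  rw [contDiff_one_iff_deriv]
  refine ⟨fun t => (hasDerivAt_profile hε t).differentiableAt, ?_⟩
  rw [deriv_eq (hasDerivAt_profile hε)]
  exact (continuous_id.max continuous_const).div (by fun_prop)
    fun t => Real.sqrt_ne_zero'.2 (by positivity)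

/-- `p_ε'(t)² + p_ε'(−t)² ≤ 1`: one of the two derivatives vanishes and the other lies in
`[0, 1)`. [folklore] -/
theorem profileDeriv_sq_add_sq_le {ε : ℝ} (hε : 0 < ε) (t : ℝ) :
    (max t 0 / Real.sqrt (ε ^ 2 + (max t 0) ^ 2)) ^ 2 +
      (max (-t) 0 / Real.sqrt (ε ^ 2 + (max (-t) 0) ^ 2)) ^ 2 ≤ 1 := by
  have key : ∀ m : ℝ, (m / Real.sqrt (ε ^ 2 + m ^ 2)) ^ 2 ≤ 1 := by
    intro m
    rw [div_pow, Real.sq_sqrt (by positivity), div_le_one (by positivity)]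
    nlinarith [sq_nonneg ε]
  rcases le_total t 0 with ht | ht
  · rw [max_eq_right ht, zero_div, zero_pow two_ne_zero, zero_add]
    exact key _
  · rw [max_eq_right (neg_nonpos.2 ht), zero_div, zero_pow two_ne_zero, add_zero]
    exact key _

/-- `p_ε(t) = 0` for `t ≤ 0` (`ε ≥ 0`). [folklore] -/
theorem profile_eq_zero {ε : ℝ} (hε : 0 ≤ ε) {t : ℝ} (ht : t ≤ 0) :
    Real.sqrt (ε ^ 2 + (max t 0) ^ 2) - ε = 0 := by
  rw [max_eq_right ht, zero_pow two_ne_zero, add_zero, Real.sqrt_sq hε, sub_self]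

/-- `0 ≤ p_ε(t)` (`ε ≥ 0`). [folklore] -/
theorem profile_nonneg {ε : ℝ} (hε : 0 ≤ ε) (t : ℝ) :
    0 ≤ Real.sqrt (ε ^ 2 + (max t 0) ^ 2) - ε :=
  sqrtReg_nonneg hε (sq_nonneg _)

/-- `p_ε(t) ≤ t⁺` (`ε ≥ 0`): `√(ε² + m²) ≤ m + ε` for `m ≥ 0`. [folklore] -/
theorem profile_le_posPart {ε : ℝ} (hε : 0 ≤ ε) (t : ℝ) :
    Real.sqrt (ε ^ 2 + (max t 0) ^ 2) - ε ≤ max t 0 := by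
  rw [sub_le_iff_le_add, Real.sqrt_le_iff]
  exact ⟨by positivity, by nlinarith [le_max_right t 0]⟩

/-- `t⁺ ≤ p_ε(t) + ε`: `m ≤ √(ε² + m²)`. [folklore] -/
theorem posPart_le_profile_add (ε t : ℝ) :
    max t 0 ≤ Real.sqrt (ε ^ 2 + (max t 0) ^ 2) - ε + ε := by
  rw [sub_add_cancel, Real.le_sqrt (le_max_right t 0) (by positivity)]
  nlinarith [sq_nonneg ε]

/-- `p_ε(t)² + p_ε(−t)² ≤ t²` (`ε ≥ 0`): `p_ε(t)² ≤ (t⁺)²` and `(t⁺)² + (t⁻)² = t²` (one of the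
two positive parts vanishes). [folklore] -/
theorem profile_sq_add_sq_le {ε : ℝ} (hε : 0 ≤ ε) (t : ℝ) :
    (Real.sqrt (ε ^ 2 + (max t 0) ^ 2) - ε) ^ 2 +
      (Real.sqrt (ε ^ 2 + (max (-t) 0) ^ 2) - ε) ^ 2 ≤ t ^ 2 := by
  refine (add_le_add (sqrtReg_sq_le hε (sq_nonneg (max t 0)))
    (sqrtReg_sq_le hε (sq_nonneg (max (-t) 0)))).trans (le_of_eq ?_)
  rcases le_total 0 t with ht | ht
  · rw [max_eq_left ht, max_eq_right (neg_nonpos.2 ht)]; ring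
  · rw [max_eq_right ht, max_eq_left (neg_nonneg.2 ht)]; ring

/-- The profile packaged: for `ε > 0` there are `p, p' : ℝ → ℝ` (namely `p_ε` and its derivative)
with `p' = dp/dt` everywhere, `p ∈ C¹`, `p(0) = 0`, `0 ≤ p ≤ (·)⁺ ≤ p + ε`, `p(t)² + p(−t)² ≤ t²`
and `p'(t)² + p'(−t)² ≤ 1`. [folklore] -/
theorem exists_profile {ε : ℝ} (hε : 0 < ε) :
    ∃ p p' : ℝ → ℝ, (∀ t, HasDerivAt p (p' t) t) ∧ ContDiff ℝ 1 p ∧ p 0 = 0 ∧ (∀ t, 0 ≤ p t) ∧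
      (∀ t, p t ≤ max t 0) ∧ (∀ t, max t 0 ≤ p t + ε) ∧ (∀ t, (p t) ^ 2 + (p (-t)) ^ 2 ≤ t ^ 2) ∧
      (∀ t, (p' t) ^ 2 + (p' (-t)) ^ 2 ≤ 1) :=
  ⟨fun s => Real.sqrt (ε ^ 2 + (max s 0) ^ 2) - ε,
    fun t => max t 0 / Real.sqrt (ε ^ 2 + (max t 0) ^ 2), hasDerivAt_profile hε,
    contDiff_profile hε, profile_eq_zero hε.le le_rfl, profile_nonneg hε.le,
    profile_le_posPart hε.le, posPart_le_profile_add ε, profile_sq_add_sq_le hε.le,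
    profileDeriv_sq_add_sq_le hε⟩

/-! ### Chain rule for `X ↦ (p (ℓ (φ X)) : ℂ)` -/

variable {E : Type*} [NormedAddCommGroup E] [NormedSpace ℝ E]

/-- Chain rule: for `φ : E → ℂ` differentiable at `X`, a real-linear functional `ℓ : ℂ →L[ℝ] ℝ` and
a profile `p` with derivative `p'`, the complexified `X ↦ (p (ℓ (φ X)) : ℂ)` has derivative
`u ↦ (p'(ℓ (φ X)) · ℓ (Dφ(X) u) : ℂ)` at `X`. [folklore] -/
theorem hasFDerivAt_ofReal_comp {p p' : ℝ → ℝ} (hp : ∀ t, HasDerivAt p (p' t) t) (ℓ : ℂ →L[ℝ] ℝ)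
    {φ : E → ℂ} {X : E} (hφ : DifferentiableAt ℝ φ X) :
    HasFDerivAt (fun Y => ((p (ℓ (φ Y)) : ℝ) : ℂ))
      (Complex.ofRealCLM.comp (p' (ℓ (φ X)) • ℓ.comp (fderiv ℝ φ X))) X := by
  have h1 : HasFDerivAt (fun Y => ℓ (φ Y)) (ℓ.comp (fderiv ℝ φ X)) X :=
    ℓ.hasFDerivAt.comp X hφ.hasFDerivAt
  have h2 : HasFDerivAt (fun Y => p (ℓ (φ Y))) (p' (ℓ (φ X)) • ℓ.comp (fderiv ℝ φ X)) X :=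
    (hp _).comp_hasFDerivAt X h1
  exact Complex.ofRealCLM.hasFDerivAt.comp X h2

/-- `‖D(p ∘ ℓ ∘ φ : ℂ)(X) u‖² = (p'(ℓ (φ X)) · ℓ (Dφ(X) u))²`. [folklore] -/
theorem norm_fderiv_ofReal_comp_sq {p p' : ℝ → ℝ} (hp : ∀ t, HasDerivAt p (p' t) t)
    (ℓ : ℂ →L[ℝ] ℝ) {φ : E → ℂ} {X : E} (hφ : DifferentiableAt ℝ φ X) (u : E) :
    ‖fderiv ℝ (fun Y => ((p (ℓ (φ Y)) : ℝ) : ℂ)) X u‖ ^ 2 =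
      (p' (ℓ (φ X)) * ℓ (fderiv ℝ φ X u)) ^ 2 := by
  rw [(hasFDerivAt_ofReal_comp hp ℓ hφ).fderiv]
  simp only [ContinuousLinearMap.comp_apply, smul_apply, smul_eq_mul,
    Complex.ofRealCLM_apply, Complex.norm_real, Real.norm_eq_abs, sq_abs]

/-! ### The four-sector algebra -/

/-- `Σ_j (p'(ℓ_j z) · ℓ_j w)² ≤ ‖w‖²` over `ℓ = (Re, −Re, Im, −Im)` when `p'(t)² + p'(−t)² ≤ 1`.
[folklore] -/
theorem four_deriv_terms_le {p' : ℝ → ℝ} (hp' : ∀ t, (p' t) ^ 2 + (p' (-t)) ^ 2 ≤ 1) (z w : ℂ) :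
    (p' z.re * w.re) ^ 2 + (p' (-z.re) * (-w.re)) ^ 2 + (p' z.im * w.im) ^ 2 +
        (p' (-z.im) * (-w.im)) ^ 2 ≤ ‖w‖ ^ 2 := by
  have h1 := hp' z.re
  have h2 := hp' z.im
  have hre := sq_nonneg w.re
  have him := sq_nonneg w.im
  calc (p' z.re * w.re) ^ 2 + (p' (-z.re) * (-w.re)) ^ 2 + (p' z.im * w.im) ^ 2 +
        (p' (-z.im) * (-w.im)) ^ 2
      = ((p' z.re) ^ 2 + (p' (-z.re)) ^ 2) * w.re ^ 2 +
          ((p' z.im) ^ 2 + (p' (-z.im)) ^ 2) * w.im ^ 2 := by ring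
    _ ≤ 1 * w.re ^ 2 + 1 * w.im ^ 2 := by gcongr
    _ = ‖w‖ ^ 2 := by rw [Complex.sq_norm, Complex.normSq_apply]; ring

/-- `Σ_j p(ℓ_j z)² ≤ ‖z‖²` over `ℓ = (Re, −Re, Im, −Im)` when `p(t)² + p(−t)² ≤ t²`. [folklore] -/
theorem four_sq_le {p : ℝ → ℝ} (hp : ∀ t, (p t) ^ 2 + (p (-t)) ^ 2 ≤ t ^ 2) (z : ℂ) :
    (p z.re) ^ 2 + (p (-z.re)) ^ 2 + (p z.im) ^ 2 + (p (-z.im)) ^ 2 ≤ ‖z‖ ^ 2 := by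
  have h1 := hp z.re
  have h2 := hp z.im
  rw [Complex.sq_norm, Complex.normSq_apply]
  nlinarith [h1, h2]

/-- The four real-linear functionals `ℓ = (Re, −Re, Im, −Im) : ℂ →L[ℝ] ℝ`, packaged with their
values. [folklore] -/
theorem exists_fourFunctionals :
    ∃ ℓ : Fin 4 → (ℂ →L[ℝ] ℝ), (∀ z, ℓ 0 z = z.re) ∧ (∀ z, ℓ 1 z = -z.re) ∧ (∀ z, ℓ 2 z = z.im) ∧
      (∀ z, ℓ 3 z = -z.im) :=
  ⟨![Complex.reCLM, -Complex.reCLM, Complex.imCLM, -Complex.imCLM], fun _ => rfl, fun _ => rfl,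
    fun _ => rfl, fun _ => rfl⟩

/-- `Σ_j (‖c_j‖₊ : ℝ≥0∞)² = ofReal (Σ_j ‖c_j‖²)` for finitely many vectors. [folklore] -/
theorem sum_coe_nnnorm_sq_eq_ofReal {ι G : Type*} [Fintype ι] [SeminormedAddCommGroup G]
    (c : ι → G) : ∑ j, ((‖c j‖₊ : ℝ≥0∞)) ^ 2 = ENNReal.ofReal (∑ j, ‖c j‖ ^ 2) := by
  rw [ENNReal.ofReal_sum_of_nonneg fun _ _ => sq_nonneg _]
  exact Finset.sum_congr rfl fun _ _ => coe_nnnorm_pow_two_eq_ofReal _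

end SmoothSectors

open SmoothSectors in
/-- **T2 — SMOOTHED PHASE SECTORS OF A TRIAL STATE.** For `Ψ ∈ TrialState N L` and `ε > 0`
there are four functions `G₀, G₁, G₂, G₃ : (ℝ³)^N → ℂ`, each `C¹`, vanishing wherever `Ψ` does,
Bose-symmetric and real nonnegative (`G_j = ‖G_j‖`), dominated IN SUM by `Ψ` — `Σ_j |∇G_j|² ≤ |∇Ψ|²`
(kinetic densities) and `Σ_j G_j² ≤ |Ψ|²` — and squeezed against the exact phase sectors:
`G₀ ≤ (Re Ψ)⁺ ≤ G₀ + ε`, `G₁ ≤ (Re Ψ)⁻ ≤ G₁ + ε`, `G₂ ≤ (Im Ψ)⁺ ≤ G₂ + ε`, `G₃ ≤ (Im Ψ)⁻ ≤ G₃ + ε` pointwise.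
Take `G_j = p_ε ∘ (Re Ψ, −Re Ψ, Im Ψ, −Im Ψ)_j` with `p_ε(t) = √(ε² + (t⁺)²) − ε`: `C¹` with `p_ε' = 0` on
`t ≤ 0` and `0 ≤ p_ε' < 1`, `p_ε(t)² + p_ε(−t)² ≤ t²`, `t⁺ − ε ≤ p_ε(t) ≤ t⁺`; `∇ Re Ψ = Re ∇Ψ`.
[cite: LiebLoss2001, Thm. 6.17] -/
theorem stub_smoothSectors : ∀ (N : ℕ) (L : ℝ) (Ψ : Literature.MathematicalPhysics.QuantumManyBody.BoseGas.TrialState N L) (ε : ℝ), 0 < ε → ∃ G : Fin 4 → (Literature.MathematicalPhysics.QuantumManyBody.BoseGas.Config N → ℂ), (∀ j, ContDiff ℝ 1 (G j)) ∧ (∀ j X, Ψ.ψ X = 0 → G j X = 0) ∧ (∀ j (σ : Equiv.Perm (Fin N)) X, G j (X ∘ σ) = G j X) ∧ (∀ j X, G j X = (‖G j X‖ : ℂ)) ∧ (∀ X, ∑ j, Literature.MathematicalPhysics.QuantumManyBody.BoseGas.kineticDensity (G j) X ≤ Literature.MathematicalPhysics.QuantumManyBody.BoseGas.kineticDensity Ψ.ψ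 X) ∧ (∀ X, ∑ j, (‖G j X‖₊ : ENNReal) ^ 2 ≤ (‖Ψ.ψ X‖₊ : ENNReal) ^ 2) ∧ (∀ X, ‖G 0 X‖ ≤ max (Ψ.ψ X).re 0 ∧ max (Ψ.ψ X).re 0 ≤ ‖G 0 X‖ + ε) ∧ (∀ X, ‖G 1 X‖ ≤ max (-(Ψ.ψ X).re) 0 ∧ max (-(Ψ.ψ X).re) 0 ≤ ‖G 1 X‖ + ε) ∧ (∀ X, ‖G 2 X‖ ≤ max (Ψ.ψ X).im 0 ∧ max (Ψ.ψ X).im 0 ≤ ‖G 2 X‖ + ε) ∧ (∀ X, ‖G 3 X‖ ≤ max (-(Ψ.ψ X).im) 0 ∧ max (-(Ψ.ψ X).im) 0 ≤ ‖G 3 X‖ + ε) := by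
  intro N L Ψ ε hε
  obtain ⟨p, p', hp, hpC, hp0, hpnn, hple, hlep, hpsq, hp'sq⟩ := exists_profile hε
  obtain ⟨ℓ, hℓ0, hℓ1, hℓ2, hℓ3⟩ := exists_fourFunctionals
  obtain ⟨G, hG⟩ : ∃ G : Fin 4 → Config N → ℂ, ∀ j X, G j X = ((p (ℓ j (Ψ.ψ X)) : ℝ) : ℂ) :=
    ⟨_, fun _ _ => rfl⟩
  have hGf : ∀ j, G j = fun X => ((p (ℓ j (Ψ.ψ X)) : ℝ) : ℂ) := fun j => funext (hG j)
  have hΨd : ∀ X, DifferentiableAt ℝ Ψ.ψ X := fun X => (Ψ.contDiff.differentiable one_ne_zero) X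
  have hnorm : ∀ j X, ‖G j X‖ = p (ℓ j (Ψ.ψ X)) := fun j X => by
    rw [hG, Complex.norm_real, Real.norm_of_nonneg (hpnn _)]
  refine ⟨G, ?_, ?_, ?_, ?_, ?_, ?_, ?_, ?_, ?_, ?_⟩
  · -- `C¹`
    intro j
    rw [hGf j]
    exact Complex.ofRealCLM.contDiff.comp (hpC.comp ((ℓ j).contDiff.comp Ψ.contDiff))
  · -- vanishing where `Ψ` vanishes
    intro j X hX
    rw [hG, hX, map_zero, hp0, Complex.ofReal_zero]
  · -- Bose symmetry
    intro j σ X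
    rw [hG, hG, Ψ.symm]
  · -- real non-negative
    intro j X
    rw [hnorm, hG]
  · -- kinetic domination, in sum
    intro X
    simp only [kineticDensity, hGf]
    refine Finset.sum_comm.trans_le (Finset.sum_le_sum fun i _ => ?_)
    refine Finset.sum_comm.trans_le (Finset.sum_le_sum fun k _ => ?_)
    rw [sum_coe_nnnorm_sq_eq_ofReal, coe_nnnorm_pow_two_eq_ofReal]
    refine ENNReal.ofReal_le_ofReal ?_
    have hF : ∀ m : ℂ →L[ℝ] ℝ, ‖fderiv ℝ (fun Y => ((p (m (Ψ.ψ Y)) : ℝ) : ℂ)) X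
        (Pi.single i (EuclideanSpace.single k (1 : ℝ)))‖ ^ 2 =
        (p' (m (Ψ.ψ X)) * m (fderiv ℝ Ψ.ψ X (Pi.single i (EuclideanSpace.single k (1 : ℝ))))) ^ 2 :=
      fun m => norm_fderiv_ofReal_comp_sq hp m (hΨd X) _
    simp only [Fin.sum_univ_four, hF, hℓ0, hℓ1, hℓ2, hℓ3]
    exact four_deriv_terms_le hp'sq _ _
  · -- modulus domination, in sum
    intro X
    rw [sum_coe_nnnorm_sq_eq_ofReal, coe_nnnorm_pow_two_eq_ofReal]
    refine ENNReal.ofReal_le_ofReal ?_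
    simp only [Fin.sum_univ_four, hnorm, hℓ0, hℓ1, hℓ2, hℓ3]
    exact four_sq_le hpsq _
  · intro X
    rw [hnorm, hℓ0]
    exact ⟨hple _, hlep _⟩
  · intro X
    rw [hnorm, hℓ1]
    exact ⟨hple _, hlep _⟩
  · intro X
    rw [hnorm, hℓ2]
    exact ⟨hple _, hlep _⟩
  · intro X
    rw [hnorm, hℓ3]
    exact ⟨hple _, hlep _⟩

end Summit.AtomisticToContinuum.BoseEinsteinCondensation.Cruxes.HardSphereBEC.Birth

end
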